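import Summits.NavierStokesRegularity.FunctionalMining.StretchingLaminateBurkholderCaseA1
import Summits.NavierStokesRegularity.FunctionalMining.StretchingLaminateBurkholderCaseA2
import Summits.NavierStokesRegularity.FunctionalMining.StretchingLaminateRecord3
import Mathlib.Tactic.Linarith
import HarnessLib

/-!
# FunctionalMining — K1-Q1 laminates, L-CAP-B kernel port (8): **`BurkConcave → C_lam ≤ 49/50`**, hence `Burkholder1991_keyFunction → C_lam ≤ 49/50`

search for candidate a priori estimates; no regularity claim.  Cell `pub-nsfunc`, prove seat gen 7 — the assembly of the
kernel port of the bank seat's THEOREM L-CAP-B (`HOME/pub-nsfunc-bank/K1Q1-LAMINATE-BURKHOLDER.md` §3/§8; dict notes 134/134a).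
The 21-interval case analysis (`caseA_all`), the leaf certificate at `(r, z, s)` (`pointClaim_rzs`: case B `s < 131/500` needs
no hypothesis; case A uses the chord), its `(m, q, s)` form (`pointClaim_mqs`), the typed leaf node
(`leafClaimB_of_burkConcave`), and
**`ratioBound_of_burkConcave : BurkConcave → RatioBound (49/50)`**, **`laminateSupConst_le_of_burkConcave`**, and the
corollaries from the vendored named fact **`ratioBound_burkholder`, `laminateSupConst_le_burkholder :
Burkholder1991_keyFunction → laminateSupConst ≤ 49/50`**, window `0.6752 ≤ C_lam ≤ 0.98` (conditional).
CONTEXT: unconditional kernel cap `C_lam ≤ 1.021188` ((aw) `StretchingLaminateCapFinal6`); bank's PAPER value `0.91`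
(528 thresholds, exact-rational certificate, two-party); the present `0.98` is the 4-threshold coarse certificate of bank §8
REDESIGNED with slack for kernel certificates (second implementation: bank's `certify_burk2.py` certifies the same design,
`HOME/code/burkcert/cert_098_g7.json`).  TRUST BASE: `BurkConcave` (the concavity clause of Burkholder's key function in `ℝ⁶`, a
typed hypothesis) resp. the vendored fact; the audit records `proof.conditional`.  The laminate cap bounds ONE lower-bound
method for `C⋆`; `C⋆` itself is untouched unless `LaminatesSharp`.
-/

noncomputable section

namespace Summit.NavierStokesRegularity.FunctionalMining

namespace Laminate

open Burk Literature.Probability.Process Finset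

/-- **Case A assembled**: the leaf certificate for `s ≥ 131/500` (all `z ≥ 0`), by the 21-interval case analysis. [ours; given `BurkConcave`] -/
theorem caseA_all (hC : BurkConcave) {r z s : ℝ} (hr0 : 0 ≤ r) (hr1 : r ≤ 1) (hz0 : 0 ≤ z) (hsA : ((131 : ℝ) / 500) ≤ s) (hsa' : 0 ≤ s - ((15 : ℝ) / 52) * z) (hsb' : 0 ≤ ((26 : ℝ) / 45) * z - s) :
    (1 - 3 / 4 * ((103 : ℝ) / 500)) * r ^ 2 * s - ((49 : ℝ) / 50) * (z ^ 2 / 2) - ((-1131 : ℝ) / 2500) * (z ^ 2 / 2 - r ^ 2 / 2) - (3 * ((103 : ℝ) / 500) / 2) * s * (2 * s ^ 2 - z ^ 2 / 2) - ((1 : ℝ) / 250000) * ((z ^ 2 / 2) ^ 3 + (10 * (z ^ 2 / 2) ^ 2 + 450 * (z ^ 2 / 2) + 1178) * (1 - r ^ 2) - 1178) - (((49 : ℝ) / 5) * (uProf (8 : ℝ) r z - abar (8 : ℝ)) + ((266 : ℝ) / 5) * (uProf (11 : ℝ) r z - abar (11 : ℝ)) + (93 : ℝ) * (uProf (17 :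 ℝ) r z - abar (17 : ℝ)) + ((303 : ℝ) / 5) * (uProf (23 : ℝ) r z - abar (23 : ℝ))) ≤ 0 := by
  rcases lt_or_ge z (((1 : ℝ) / 2)) with hlt | hge'
  · exact caseA_0 hC hr0 hr1 hz0 hsA hsa' hsb' hz0 hlt.le
  have hge := hge'
  rcases lt_or_ge z ((1 : ℝ)) with hlt | hge'
  · exact caseA_1 hC hr0 hr1 hz0 hsA hsa' hsb' hge hlt.le
  have hge := hge'
  rcases lt_or_ge z ((2 : ℝ)) with hlt | hge'
  · exact caseA_2 hC hr0 hr1 hz0 hsA hsa' hsb' hge hlt.le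
  have hge := hge'
  rcases lt_or_ge z ((4 : ℝ)) with hlt | hge'
  · exact caseA_3 hC hr0 hr1 hz0 hsA hsa' hsb' hge hlt.le
  have hge := hge'
  rcases lt_or_ge z ((7 : ℝ)) with hlt | hge'
  · exact caseA_4 hC hr0 hr1 hz0 hsA hsa' hsb' hge hlt.le
  have hge := hge'
  rcases lt_or_ge z (((397 : ℝ) / 50)) with hlt | hge'
  · exact caseA_5 hC hr0 hr1 hz0 hsA hsa' hsb' hge hlt.le
  have hge := hge'
  rcases lt_or_ge z ((8 : ℝ)) with hlt | hge'
  · exact caseA_6 hC hr0 hr1 hz0 hsA hsa' hsb' hge hlt.le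
  have hge := hge'
  rcases lt_or_ge z ((10 : ℝ)) with hlt | hge'
  · exact caseA_7 hC hr0 hr1 hz0 hsA hsa' hsb' hge hlt.le
  have hge := hge'
  rcases lt_or_ge z (((274 : ℝ) / 25)) with hlt | hge'
  · exact caseA_8 hC hr0 hr1 hz0 hsA hsa' hsb' hge hlt.le
  have hge := hge'
  rcases lt_or_ge z ((11 : ℝ)) with hlt | hge'
  · exact caseA_9 hC hr0 hr1 hz0 hsA hsa' hsb' hge hlt.le
  have hge := hge'
  rcases lt_or_ge z ((16 : ℝ)) with hlt | hge'
  · exact caseA_10 hC hr0 hr1 hz0 hsA hsa' hsb' hge hlt.le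
  have hge := hge'
  rcases lt_or_ge z (((849 : ℝ) / 50)) with hlt | hge'
  · exact caseA_11 hC hr0 hr1 hz0 hsA hsa' hsb' hge hlt.le
  have hge := hge'
  rcases lt_or_ge z ((17 : ℝ)) with hlt | hge'
  · exact caseA_12 hC hr0 hr1 hz0 hsA hsa' hsb' hge hlt.le
  have hge := hge'
  rcases lt_or_ge z ((22 : ℝ)) with hlt | hge'
  · exact caseA_13 hC hr0 hr1 hz0 hsA hsa' hsb' hge hlt.le
  have hge := hge'
  rcases lt_or_ge z (((1149 : ℝ) / 50)) with hlt | hge'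
  · exact caseA_14 hC hr0 hr1 hz0 hsA hsa' hsb' hge hlt.le
  have hge := hge'
  rcases lt_or_ge z ((23 : ℝ)) with hlt | hge'
  · exact caseA_15 hC hr0 hr1 hz0 hsA hsa' hsb' hge hlt.le
  have hge := hge'
  rcases lt_or_ge z ((30 : ℝ)) with hlt | hge'
  · exact caseA_16 hC hr0 hr1 hz0 hsA hsa' hsb' hge hlt.le
  have hge := hge'
  rcases lt_or_ge z (((3149 : ℝ) / 100)) with hlt | hge'
  · exact caseA_17 hC hr0 hr1 hz0 hsA hsa' hsb' hge hlt.le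
  have hge := hge'
  rcases lt_or_ge z ((40 : ℝ)) with hlt | hge'
  · exact caseA_18 hC hr0 hr1 hz0 hsA hsa' hsb' hge hlt.le
  have hge := hge'
  rcases lt_or_ge z ((60 : ℝ)) with hlt | hge'
  · exact caseA_19 hC hr0 hr1 hz0 hsA hsa' hsb' hge hlt.le
  have hge := hge'
  exact caseA_20 hC hr0 hr1 hz0 hsA hsa' hsb' hge


/-- **The leaf certificate at `(r, z, s)`** (`r = |ω|`, `z = √2|S|`, `s = s₁(S)`, unit ceiling): case B (`s < 131/500`) by
the near-origin forms (no hypothesis), case A by the faces (chord, from `BurkConcave`). [ours; given `BurkConcave`] -/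
theorem pointClaim_rzs (hC : BurkConcave) {r z s : ℝ} (hr0 : 0 ≤ r) (hr1 : r ≤ 1) (hz0 : 0 ≤ z)
    (hsa : ((15 : ℝ) / 52) * z ≤ s) (hsb : s ≤ ((26 : ℝ) / 45) * z) : (1 - 3 / 4 * ((103 : ℝ) / 500)) * r ^ 2 * s - ((49 : ℝ) / 50) * (z ^ 2 / 2) - ((-1131 : ℝ) / 2500) * (z ^ 2 / 2 - r ^ 2 / 2) - (3 * ((103 : ℝ) / 500) / 2) * s * (2 * s ^ 2 - z ^ 2 / 2) - ((1 : ℝ) / 250000) * ((z ^ 2 / 2) ^ 3 + (10 * (z ^ 2 / 2) ^ 2 + 450 * (z ^ 2 / 2) + 1178) * (1 - r ^ 2) - 1178) - (((49 : ℝ) / 5) * (uProf (8 : ℝ) r z - abar (8 : ℝ)) + ((266 : ℝ) / 5) * (uProf (11 : ℝ) r z - abar (11 : ℝ)) + (93 : ℝ) * (uProf (17 : ℝ) r z - abar (17 : ℝ)) + ((303 : ℝ) / 5) * (uProf (23 : ℝ) r z - abar (23 : ℝ))) ≤ 0 := by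
  rcases lt_or_ge s ((131 : ℝ) / 500) with hsB | hsA
  · exact caseB_finish hr0 hr1 hz0 hsB hsa hsb
  · exact caseA_all hC hr0 hr1 hz0 hsA (by linarith) (by linarith)

/-- **The pointwise claim in `(m, q, s)`** (`m = |ω|² ≤ 1`, `q = |S|²`, `s` the top eigenvalue: `q ≤ 6s²`, `3s² ≤ 2q`):
the hypothesis of `leafClaimB_of_point` for the design multipliers. [ours; given `BurkConcave`] -/
theorem pointClaim_mqs (hC : BurkConcave) (m q s : ℝ) (hm0 : 0 ≤ m) (hm1 : m ≤ 1) (hq : 0 ≤ q)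
    (hs : 0 ≤ s) (hlo : q ≤ 6 * s ^ 2) (hhi : 3 * s ^ 2 ≤ 2 * q) : (1 - 3 / 4 * ((103 : ℝ) / 500)) * m * s - ((49 : ℝ) / 50) * q - ((-1131 : ℝ) / 2500) * (q - m / 2) - (3 * ((103 : ℝ) / 500) / 2) * s * (2 * s ^ 2 - q) - ((1 : ℝ) / 250000) * (q ^ 3 + (10 * q ^ 2 + 450 * q + 1178) * (1 - m) - 1178) - (((49 : ℝ) / 5) * (uProf (8 : ℝ) (Real.sqrt m) (Real.sqrt (2 * q)) - abar (8 : ℝ)) + ((266 : ℝ) / 5) * (uProf (11 : ℝ) (Real.sqrt m) (Real.sqrt (2 * q)) - abar (11 : ℝ)) + (93 : ℝ) * (uProf (17 : ℝ) (Real.sqrt m) (Real.sqrt (2 * q)) - abar (17 : ℝ)) + ((303 : ℝ) / 5) * (uProf (23 : ℝ) (Real.sqrt m) (Real.sqrt (2 * q)) - abar (23 : ℝ))) ≤ 0 := by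
  obtain ⟨r, hr⟩ : ∃ r : ℝ, r = Real.sqrt m := ⟨_, rfl⟩
  obtain ⟨z, hz⟩ : ∃ z : ℝ, z = Real.sqrt (2 * q) := ⟨_, rfl⟩
  have hr0 : 0 ≤ r := by rw [hr]; exact Real.sqrt_nonneg _
  have hz0 : 0 ≤ z := by rw [hz]; exact Real.sqrt_nonneg _
  have hrm : r ^ 2 = m := by rw [hr]; exact Real.sq_sqrt hm0
  have hzq : z ^ 2 = 2 * q := by rw [hz]; exact Real.sq_sqrt (by linarith)
  have hr1 : r ≤ 1 := by nlinarith
  have hsa : ((15 : ℝ) / 52) * z ≤ s :=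
    (pow_le_pow_iff_left₀ (by positivity) hs two_ne_zero).1 (by rw [mul_pow, hzq]; nlinarith)
  have hsb : s ≤ ((26 : ℝ) / 45) * z :=
    (pow_le_pow_iff_left₀ hs (by positivity) two_ne_zero).1 (by rw [mul_pow, hzq]; nlinarith)
  have key := pointClaim_rzs hC hr0 hr1 hz0 hsa hsb
  rw [← hr, ← hz]
  rw [hrm, hzq] at key
  have hq2 : (2 * q) / 2 = q := by ring
  rw [hq2] at key
  linarith [key]

/-- **The typed leaf node for the design multipliers**, `θ = 49/50`:
`LeafClaimB (49/50) (−1131/2500) (103/500) (1/250000) (8,11,17,23) (49/5,266/5,93,303/5)`. [ours; given `BurkConcave`] -/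
theorem leafClaimB_of_burkConcave (hC : BurkConcave) :
    LeafClaimB (49 / 50) (-1131 / 2500) (103 / 500) (1 / 250000) ![(8 : ℝ), 11, 17, 23]
      ![(49 : ℝ) / 5, 266 / 5, 93, 303 / 5] := by
  refine leafClaimB_of_point (by norm_num) ?_
  intro m q s hm0 hm1 hq hs hlo hhi
  have key := pointClaim_mqs hC m q s hm0 hm1 hq hs hlo hhi
  simp only [Fin.sum_univ_four, Matrix.cons_val_zero, Matrix.cons_val_one, Matrix.cons_val]
  norm_num at key ⊢
  linarith [key]

/-- **`BurkConcave → RatioBound (49/50)`**: every finite rational div-free lamination tree has `σ(𝒯) ≤ (49/50)·M(𝒯)·E(𝒯)`,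
GIVEN only the concavity clause in `ℝ⁶` (the dischargeable form). [ours; given `BurkConcave`] -/
theorem ratioBound_of_burkConcave (hC : BurkConcave) : RatioBound (49 / 50) :=
  ratioBound_of_leafClaimBC hC (leafClaimB_of_burkConcave hC) (by norm_num)
    (fun k => by fin_cases k <;> simp <;> norm_num) (fun k => by fin_cases k <;> simp <;> norm_num)

/-- **`BurkConcave → C_lam ≤ 49/50 = 0.98`.** [ours; given `BurkConcave`] -/
theorem laminateSupConst_le_of_burkConcave (hC : BurkConcave) : laminateSupConst ≤ 49 / 50 :=
  laminateSupConst_le_of_ratioBound (ratioBound_of_burkConcave hC)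

/-- **THEOREM L-CAP-B (kernel, conditional): `Burkholder1991_keyFunction → RatioBound (49/50)`.**  Trust base: the vendored
named fact `Literature.Probability.Process.Burkholder1991_keyFunction` (Burkholder 1991, LNM 1464, Thm 8.1 key function), of
which only the concavity clause in `ℝ⁶` is used (`BurkConcave`); everything else is kernel-checked (isometry, laminate Betchov,
sextic moment, the scaled supermartingale `(TB)` and its `σ → 1⁻` limit, the thirty polynomial certificates).
search for candidate a priori estimates; no regularity claim. [ours; conditional on `Burkholder1991_keyFunction`] -/
theorem ratioBound_burkholder (hBK : Burkholder1991_keyFunction) : RatioBound (49 / 50) :=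
  ratioBound_of_burkConcave (burkConcave_of_keyFunction hBK)

/-- **`Burkholder1991_keyFunction → C_lam ≤ 49/50 = 0.98`** (unconditionally `C_lam ≤ 1.021188`, (aw)/CapFinal6; bank's PAPER
value `0.91` uses 528 thresholds).  A cap on the laminate METHOD; `C⋆` is untouched unless `LaminatesSharp`.
[ours; conditional on `Burkholder1991_keyFunction`] -/
theorem laminateSupConst_le_burkholder (hBK : Burkholder1991_keyFunction) : laminateSupConst ≤ 49 / 50 :=
  laminateSupConst_le_of_burkConcave (burkConcave_of_keyFunction hBK)

/-- **Conditional laminate window `0.6752 ≤ C_lam ≤ 0.98`.** [ours; conditional on `Burkholder1991_keyFunction`] -/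
theorem laminateSupConst_window_burkholder (hBK : Burkholder1991_keyFunction) :
    (422 / 625 : ℝ) ≤ laminateSupConst ∧ laminateSupConst ≤ 49 / 50 :=
  ⟨e800_le_laminateSupConst, laminateSupConst_le_burkholder hBK⟩

end Laminate

end Summit.NavierStokesRegularity.FunctionalMining

end
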